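import Summits.QuantumFields.YangMills.Theorems.BalabanUVNodesN11TopPairQuadSlot

/-!
# DAG node N11 — THE `quad` SLOT AT THE TOP PAIR, II: K1⁹'s FOUR HYPOTHESIS-SIDE CONJUNCTS (`Provisos₁₃SepCoPH`, `ZhUnity`, `SlotsNondegenerate₁₃`, `Admissible`) TRANSFER TO
# THE SWITCH-AND-DIAL RE-PIN — so inside K1⁹'s antecedent class the top-pair conjunct of the first 𝐓-law holds BY FIAT for any prescribed terms (count-neutral, LOCATED)

HEADER — WORK-UNIT METADATA.  Cell `pub-ymgap`, YM-PLAN Track A (HUMAN RULING D-0062), seat `pub-ymgap-dag-n11-d` (g34; N11 [B14], s2), route `BalabanUVNodes`, item K1⁹ =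
stmt-QuantumFields-27364 (helper lane, `--kind proof --supports 27364 --as helper`, count-neutral).  [III] = [Balaban1988Convergent], [I] = [Balaban1987RG1].  Over this seat's
`…N11TopPairQuadSlot` (g34: §3 ★★★★ `exists_zh_top_pair_identity_by_fiat` — next to every `θ` a re-pin of the residual at the top histories of length `1` (SWITCH `R_p V′ = ∅ ↔
0 < 𝐓ρ₀(𝕋,𝕋)(V′)`, DIAL `quad_0(𝕋) := 2·A_1(s′;u_p,e_p)(U_1 V_1) − 2·log 𝐓ρ₀(𝕋,𝕋)(V_1)`) with the rows `zhLocal` ∕ `zhLaws` ∕ `ZhUnity` transferred, at which old side `=` new side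
at every coarse field with `0 ≤ 𝐓ρ₀`; `slotsTOfRecord_nonneg_of_provisos₁₃CoPH`) and node00-def-T's RECORD 13 v1.7∕v1.8 `H` (`Stage13HParams.Provisos₁₃SepCoPH` — FILE 28T, thirteen rows of
which only `zhLaws` ∕ `zhLocal` read `Zh`; `.toCore`; `Stage13Params.SlotsNondegenerate₁₃` ∕ `.Admissible`, read through `toStage13Params`).

WHY THIS FILE.  K1⁹ = stmt-QuantumFields-27364 quantifies `∃ θ : Stage13HParams F 2` under the hypothesis-side conjuncts `θ.Provisos₁₃SepCoPH ∧ (θ.ZhUnity ∧ θ.SlotsNondegenerate₁₃) ∧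
θ.Admissible`.  The companion's re-pin changes ONLY `θ.Zh` (at the top histories of length `1`); twelve of the thirteen rows of `Provisos₁₃SepCoPH` and both of `SlotsNondegenerate₁₃`,
`Admissible` read `θ.toStage13RParams` only, and the two rows that read `Zh` (`zhLaws`, `zhLocal`) and the guard `ZhUnity` transfer (companion §3).  Hence (§1) the four conjuncts
transport along equal `Stage13RParams` data, and (§2) from ANY `θ` in K1⁹'s hypothesis class there is a `θ′` IN THE SAME CLASS at which — for every run `p`, the top history
`s′ = (𝕋, 𝕋)` and the prescribed terms `(u_p, e_p)` — `𝐓ρ₀(𝕋,𝕋)(V′) = sect2Slot(W^{θ′}(s′), s′, u_p, e_p, U_1)(V′)` at EVERY coarse field (`0 ≤ 𝐓ρ₀` from the rows `zetaUnity` ∕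
`zetaAbs`), so the (O3′) conjunct of `TLaw₁₃CoPH θ′ p 0` at `(𝕋, 𝕋)` (`tLaw₁₃CoPH_iff`, second component at `s′`) holds with NOTHING of [I] ∕ [III].  What the first 𝐓-law asks of a K1⁹
witness at the top pair is decided by the pin of `quad` (object C2; or the law «`quad_j = 0` at zero fluctuation field», companion §1), not by K1⁹'s displayed provisos.

WHAT THIS FILE PROVES (0 `def`, 0 `sorry`, standard axioms).  §1 `provisos₁₃SepCoPH_of_sameR` · `provisos₁₃CoPH_of_sameR` · `slotsNondegenerate₁₃_of_sameR` · `admissible_of_sameR`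
(transport along `θ′.toStage13RParams = θ.toStage13RParams` given the two `Zh` rows at `θ′`).  §2 ★★★★★ `exists_zh_top_pair_O3_by_fiat_of_hypotheses`.

HONEST FRAMING.  A READING on the tree's own rows (count-neutral, LOCATED): nothing of Bałaban asserted or refuted; the re-pin is NOT print's `⟨A, 𝒬A⟩` and NOT print's (3.2) region map —
it exploits the absence of a law on `quad`; K1⁹'s `∃θ` NOT advanced and NOT refuted (the other histories of the first 𝐓-law, the term laws `Sect2.LawsT`, every later law and the
consequent's faces are untouched); no `Stage13HParams` of record constructed or modified; N11 NOT discharged; K1⁹ NOT closed; no registered stub touched; counts unmoved (typed 28∕28 ·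
discharged 8∕27).  One finite four-torus programme at fixed `ε = L^{−K}`; NOT ℝ⁴, NOT OS, NOT a mass gap, NOT Clay.  No `sorry`, `axiom`, `def`, `instance`, `notation`.  Sources (SHAPE
only): [III] Thm 1 p.262, remark p.262, (2.18) p.257, (2.21)–(2.23) p.258, p.267, (3.2)–(3.9) pp.265–266, (3.16) p.268, (3.22) p.269, (3.23)–(3.25) p.270; [I] Thm 1 p.259, (2.9) p.266.
-/

noncomputable section

open MeasureTheory
open scoped BigOperators Matrix.Norms.L2Operator

namespace Summit.QuantumFields.YangMills.Theorems.BalabanUVNodesN11TopPairQuadSlotK1Hypotheses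

open Literature.MathematicalPhysics.QuantumFieldTheory.Balaban1983to89 T4Continuum Node00 Node00.Tk B14.Eq218Concrete B14.Sect3Decomp
open BalabanUVNodesN11TopPairQuadSlot (exists_zh_top_pair_identity_by_fiat slotsTOfRecord_nonneg_of_provisos₁₃CoPH)

variable {F : T4Family} {N : ℕ} [NeZero N]

/-! ## §1. K1⁹'s hypothesis-side conjuncts transport along equal `Stage13RParams` data -/

section Hypotheses

variable {θ θ' : Stage13HParams F N}

/-- **THE SEPARATED-RANGE PROVISOS TRANSPORT ALONG EQUAL `Stage13RParams` DATA** given the two residual rows at the new parameter: of the thirteen rows of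
`Provisos₁₃SepCoPH` only `zhLaws` ∕ `zhLocal` read `Zh` (FILE 28T: «NO row … reads θ.Zt or θ.Zr»; the others read `ν`, `τ9`, `ζ`, `A₁`, `ppSel`, `Rz`, `γ`, … at
`θ.toStage13RParams`). [cite: Balaban1988Convergent, (2.18) p.257, (2.21) p.258, (3.2)–(3.9) pp.265–266, (3.16) p.268 (bookkeeping)] -/
theorem provisos₁₃SepCoPH_of_sameR (h1 : θ'.toStage13RParams = θ.toStage13RParams) (hP : θ.Provisos₁₃SepCoPH F N)
    (hL : ∀ p n Ω Λ, (θ'.Zh p n Ω Λ).Laws) (hloc : ∀ p n Ω Λ, (θ'.Zh p n Ω Λ).LocalLaws) : θ'.Provisos₁₃SepCoPH F N := by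
  obtain ⟨R', Zh', Phih'⟩ := θ'
  cases h1
  exact { intPiece := hP.intPiece, measω := hP.measω, measChi := hP.measChi, zetaUnity := hP.zetaUnity, zetaAbs := hP.zetaAbs,
          rstep := fun p k _ hk => hP.rstep p k hk, rzLaws := hP.rzLaws, zhLaws := hL, zhLocal := hloc, hM := hP.hM, hM₁ := hP.hM₁, bg := hP.bg,
          zetaMeas := hP.zetaMeas }

/-- … and so do the bg-free core provisos `Provisos₁₃CoPH`. [cite: Balaban1988Convergent, (2.21) p.258, (3.16) p.268 (bookkeeping)] -/
theorem provisos₁₃CoPH_of_sameR (h1 : θ'.toStage13RParams = θ.toStage13RParams) (hP : θ.Provisos₁₃CoPH F N)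
    (hL : ∀ p n Ω Λ, (θ'.Zh p n Ω Λ).Laws) (hloc : ∀ p n Ω Λ, (θ'.Zh p n Ω Λ).LocalLaws) : θ'.Provisos₁₃CoPH F N := by
  obtain ⟨R', Zh', Phih'⟩ := θ'
  cases h1
  exact { intPiece := hP.intPiece, measω := hP.measω, measChi := hP.measChi, zetaUnity := hP.zetaUnity, zetaAbs := hP.zetaAbs,
          rstep := fun p k _ hk => hP.rstep p k hk, rzLaws := hP.rzLaws, zhLaws := hL, zhLocal := hloc, zetaMeas := hP.zetaMeas }

/-- `SlotsNondegenerate₁₃` reads `toStage13Params` only: it transports along equal `Stage13RParams` data. [cite: Balaban1988Convergent, (3.22) p.269 (bookkeeping)] -/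
theorem slotsNondegenerate₁₃_of_sameR (h1 : θ'.toStage13RParams = θ.toStage13RParams) (hS : θ.SlotsNondegenerate₁₃ F N) : θ'.SlotsNondegenerate₁₃ F N := by
  obtain ⟨R', Zh', Phih'⟩ := θ'
  cases h1
  exact hS

/-- `Admissible` reads `toStage13Params` only: it transports along equal `Stage13RParams` data. [cite: Balaban1987RG1, (2.9) p.266 (bookkeeping)] -/
theorem admissible_of_sameR (h1 : θ'.toStage13RParams = θ.toStage13RParams) (hA : θ.Admissible F N) : θ'.Admissible F N := by
  obtain ⟨R', Zh', Phih'⟩ := θ'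
  cases h1
  exact hA

end Hypotheses

/-! ## §2. Inside K1⁹'s hypothesis class the top-pair conjunct of the first 𝐓-law holds by fiat -/

section Fiat

/-- ★★★★★ **K1⁹'s HYPOTHESIS LIST DOES NOT EXCLUDE THE FIAT**: if `θ` carries K1⁹'s antecedent conjuncts — `Provisos₁₃SepCoPH`, `ZhUnity`, `SlotsNondegenerate₁₃`, `Admissible` —
then for every term assignment `u_p` and constants `e_p` there is a parameter `θ′` carrying THE SAME FOUR CONJUNCTS, with the same `Stage13RParams` data and `Phih`, the same residual at
every history other than the top ones of length `1`, at which, for every run `p` and the top history `s′ = (𝕋, 𝕋)`: OLD SIDE = NEW SIDE at EVERY coarse field (`0 ≤ 𝐓ρ₀` now from the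
rows `zetaUnity` ∕ `zetaAbs`), hence the (O3′) conjunct of `TLaw₁₃CoPH θ′ p 0` at `s′` (`tLaw₁₃CoPH_iff`, history `s′`, second component) HOLDS for the terms `(u_p, e_p)` — by the switch and
the dial alone.  What the first 𝐓-law asks of a K1⁹ witness at the top pair is therefore decided by the PIN of `quad` (C2: [I]'s `⟨A, 𝒬 A⟩`, vanishing at zero fluctuation field — §1), not by
K1⁹'s displayed provisos.  LOCATED, count-neutral; K1⁹'s `∃θ` neither advanced nor refuted; N11 NOT discharged. [cite: Balaban1988Convergent, Thm 1 p.262, remark p.262, (2.18) p.257, (2.21)–(2.23) p.258, (3.2) p.265, p.267, (3.23)–(3.25) p.270] -/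
theorem exists_zh_top_pair_O3_by_fiat_of_hypotheses (θ : Stage13HParams F N) (hP : θ.Provisos₁₃SepCoPH F N) (hU : θ.ZhUnity)
    (hS : θ.SlotsNondegenerate₁₃ F N) (hA : θ.Admissible F N)
    (u : (p : B12.RunParams) → (M : ℕ) → Sect2.TermValues (F.P p.K) (MatA N) (FluctV N) M) (e : B12.RunParams → ℝ) :
    ∃ θ' : Stage13HParams F N, θ'.toStage13RParams = θ.toStage13RParams ∧ θ'.Phih = θ.Phih ∧
      (∀ p n Ω Λ, ¬ (n = 1 ∧ Ω 1 = Set.univ ∧ Λ 1 = Set.univ) → θ'.Zh p n Ω Λ = θ.Zh p n Ω Λ) ∧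
      θ'.Provisos₁₃SepCoPH F N ∧ (θ'.ZhUnity ∧ θ'.SlotsNondegenerate₁₃ F N) ∧ θ'.Admissible F N ∧
      ∀ (p : B12.RunParams) (s' : SeqOfRecord F θ'.ν θ'.τ9.M (gOfRecord₁₃ F N θ'.toStage13Params p) p.K 1), s'.Ω 1 = Set.univ → s'.Λ 1 = Set.univ →
        (∀ V' : GaugeField (F.P p.K) 1 (SU N),
          slotsTOfRecord F N θ'.ν θ'.τ9 (EOfRecord₁₃ F N θ'.toStage13Params) (wOfRecord₉ F N θ'.toStage9Params) θ'.ppSel p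
              (gOfRecord₁₃ F N θ'.toStage13Params p) 1 s' V' =
            sect2Slot F N (FluctV N) p.K (settingOfRecord₁₃ F N θ'.toStage13Params p) (θ'.rzAt p s') (WtOfRecord₁₃H F N θ' p s') s' (u p θ'.τ9.M) (e p)
              (UbgOfRecord₁₃CoP F N θ'.toStage13Params p 1 s') V') ∧
        (slotsTOfRecord F N θ'.ν θ'.τ9 (EOfRecord₁₃ F N θ'.toStage13Params) (wOfRecord₉ F N θ'.toStage9Params) θ'.ppSel p (gOfRecord₁₃ F N θ'.toStage13Params p) 1 s' = 0 ∨
          ∀ᵐ V' ∂fieldMeasure (F.P p.K) 1 (SU N),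
            chiSeqOfRecord F N θ'.ν θ'.τ9.M (gOfRecord₁₃ F N θ'.toStage13Params p) p.K 1 s' V' ≠ 0 →
              slotsTOfRecord F N θ'.ν θ'.τ9 (EOfRecord₁₃ F N θ'.toStage13Params) (wOfRecord₉ F N θ'.toStage9Params) θ'.ppSel p
                  (gOfRecord₁₃ F N θ'.toStage13Params p) 1 s' V' =
                sect2Slot F N (FluctV N) p.K (settingOfRecord₁₃ F N θ'.toStage13Params p) (θ'.rzAt p s') (WtOfRecord₁₃H F N θ' p s') s' (u p θ'.τ9.M) (e p)
                  (UbgOfRecord₁₃CoP F N θ'.toStage13Params p 1 s') V') := by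
  obtain ⟨θ', h1, h2, hoff, hloc, hlaws, hun, hid⟩ := exists_zh_top_pair_identity_by_fiat θ u e
  have hP' : θ'.Provisos₁₃SepCoPH F N := provisos₁₃SepCoPH_of_sameR h1 hP (hlaws hP.zhLaws) (hloc hP.zhLocal)
  refine ⟨θ', h1, h2, hoff, hP', ⟨hun hU, slotsNondegenerate₁₃_of_sameR h1 hS⟩, admissible_of_sameR h1 hA, fun p s' hΩ hΛ => ?_⟩
  have hpt := fun V' => hid p s' hΩ hΛ V' (slotsTOfRecord_nonneg_of_provisos₁₃CoPH θ' p hP'.toCore s' V')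
  exact ⟨hpt, Or.inr (Filter.Eventually.of_forall fun V' _ => hpt V')⟩

end Fiat

end Summit.QuantumFields.YangMills.Theorems.BalabanUVNodesN11TopPairQuadSlotK1Hypotheses

end
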